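import Mathlib

/-!
# Stub `stub_repairAsymptotics` — crux stmt-PneNP-2463 (`SolvableImpliesStableSection`), line `Sketch`

Block "one round of local repair" for random `k`-SAT at clause density `α` (`m ≤ α n` clauses): the
mean fraction of violated clauses after one repair round is at most
`u_n(m) := 2^{-k}((1 + 2^{-k}((1 + 1/n)^k - 1))^m - 1)`, whose limit is
`ν₁ := 2^{-k}(e^{kα2^{-k}} - 1)`.  We show that `u_n(m)` is eventually (in `n`, uniformly in
`m ≤ α n`) at most the midpoint `(ν₁ + ν)/2` for every `ν > ν₁`.

Proof: with `t := 2^{-k}((1 + 1/n)^k - 1) ≥ 0`, `(1 + t)^m ≤ e^{m t} ≤ e^{α n t}`, and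
`n((1 + 1/n)^k - 1) ≤ n(e^{k/n} - 1) ≤ k e^{k/n}` (`1 + x ≤ eˣ`, `eˣ - 1 ≤ x eˣ`), so
`u_n(m) ≤ 2^{-k}(exp(kα2^{-k} e^{k/n}) - 1) → ν₁ < (ν₁ + ν)/2` by continuity.
-/

set_option linter.dupNamespace false

namespace Summit.PneNP.PneNP.Cruxes.SolvableImpliesStableSection.Sketch

open Finset Filter
open scoped Classical Topology

/-- `n((1 + 1/n)^k - 1) ≤ k e^{k/n}` for `n ≥ 1`: `(1 + 1/n)^k ≤ e^{k/n}` and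
`e^{k/n} - 1 ≤ (k/n) e^{k/n}`. -/
theorem rasy_nat_mul_pow_sub_one_le (k n : ℕ) (hn : 0 < n) :
    (n : ℝ) * ((1 + 1 / (n : ℝ)) ^ k - 1) ≤ k * Real.exp (k / n) := by
  have hn' : (0 : ℝ) < n := by exact_mod_cast hn
  have hn0 : (n : ℝ) ≠ 0 := hn'.ne'
  have h1 : (1 + 1 / (n : ℝ)) ^ k ≤ Real.exp (k / n) := by
    calc (1 + 1 / (n : ℝ)) ^ k ≤ Real.exp (1 / n) ^ k :=
          pow_le_pow_left₀ (by positivity) (by linarith [Real.add_one_le_exp (1 / (n : ℝ))]) k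
      _ = Real.exp (k / n) := by rw [← Real.exp_nat_mul]; congr 1; field_simp
  -- `eˣ - 1 ≤ x eˣ` (tree: `Literature.Analysis.ODE.exp_sub_one_le_mul_exp`; three lines, inlined to
  -- keep this file on `import Mathlib` only): from `1 - x ≤ e^{-x}` multiplied by `eˣ > 0`.
  have h2 : Real.exp ((k : ℝ) / n) - 1 ≤ (k : ℝ) / n * Real.exp ((k : ℝ) / n) := by
    have h := Real.add_one_le_exp (-((k : ℝ) / n))
    have hpos := Real.exp_pos ((k : ℝ) / n)
    have hmul : Real.exp (-((k : ℝ) / n)) * Real.exp ((k : ℝ) / n) = 1 := by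
      rw [← Real.exp_add]; simp
    nlinarith [mul_le_mul_of_nonneg_right h hpos.le, hmul]
  calc (n : ℝ) * ((1 + 1 / (n : ℝ)) ^ k - 1) ≤ n * (Real.exp (k / n) - 1) :=
        mul_le_mul_of_nonneg_left (by linarith) hn'.le
    _ ≤ n * ((k : ℝ) / n * Real.exp (k / n)) := mul_le_mul_of_nonneg_left h2 hn'.le
    _ = k * Real.exp (k / n) := by field_simp

/-- **Stub 6 — asymptotics of the mean.** For `m ≤ α n`,
`2^{-k}((1 + 2^{-k}((1+1/n)^k - 1))^m - 1)` is eventually (in `n`, uniformly in `m ≤ α n`) at most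
the midpoint between its limit `2^{-k}(e^{kα2^{-k}} - 1)` and any larger `ν`. -/
theorem stub_repairAsymptotics (k : ℕ) (hk : 1 ≤ k) (α ν : ℝ) (hα : 0 < α)
    (hν : (1 / 2 : ℝ) ^ k * (Real.exp (k * α * (1 / 2 : ℝ) ^ k) - 1) < ν) :
    ∀ᶠ n : ℕ in Filter.atTop, ∀ m : ℕ, (m : ℝ) ≤ α * n →
      (1 / 2 : ℝ) ^ k * ((1 + (1 / 2 : ℝ) ^ k * ((1 + 1 / (n : ℝ)) ^ k - 1)) ^ m - 1)
        ≤ ((1 / 2 : ℝ) ^ k * (Real.exp (k * α * (1 / 2 : ℝ) ^ k) - 1) + ν) / 2 := by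
  set c : ℝ := (1 / 2 : ℝ) ^ k with hc
  have hc0 : 0 < c := by positivity
  -- the comparison sequence `c (exp (k α c e^{k/n}) - 1)` tends to `ν₁ = c (exp (k α c) - 1)`
  have hlim : Tendsto (fun n : ℕ => Real.exp ((k : ℝ) / n)) atTop (𝓝 1) :=
    Real.tendsto_exp_nhds_zero_nhds_one.comp (tendsto_const_div_atTop_nhds_zero_nat (k : ℝ))
  have hG : Tendsto (fun n : ℕ => c * (Real.exp (k * α * c * Real.exp ((k : ℝ) / n)) - 1)) atTop
      (𝓝 (c * (Real.exp (k * α * c * 1) - 1))) := by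
    have hFc : Continuous (fun y : ℝ => c * (Real.exp (k * α * c * y) - 1)) := by fun_prop
    exact (hFc.tendsto 1).comp hlim
  rw [mul_one] at hG
  have hmid : c * (Real.exp (k * α * c) - 1) < (c * (Real.exp (k * α * c) - 1) + ν) / 2 := by
    linarith
  filter_upwards [hG.eventually_le_const hmid, eventually_gt_atTop 0] with n hn hn0 m hm
  -- pointwise bound for `n ≥ 1`, `m ≤ α n`
  have hnR : (0 : ℝ) < n := by exact_mod_cast hn0
  set t : ℝ := c * ((1 + 1 / (n : ℝ)) ^ k - 1) with ht
  -- `t > 0` since `k ≥ 1` and `n ≥ 1`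
  have ht0 : 0 < t := by
    have h1 : (1 : ℝ) < (1 + 1 / (n : ℝ)) ^ k :=
      one_lt_pow₀ (by simp only [lt_add_iff_pos_right]; positivity) (Nat.one_le_iff_ne_zero.mp hk)
    exact mul_pos hc0 (by linarith)
  have h1 : (1 + t) ^ m ≤ Real.exp (α * n * t) := by
    calc (1 + t) ^ m ≤ Real.exp t ^ m :=
          pow_le_pow_left₀ (by linarith) (by linarith [Real.add_one_le_exp t]) m
      _ = Real.exp (m * t) := (Real.exp_nat_mul t m).symm
      _ ≤ Real.exp (α * n * t) := Real.exp_le_exp.mpr (mul_le_mul_of_nonneg_right hm ht0.le)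
  have h2 : α * n * t ≤ k * α * c * Real.exp (k / n) := by
    have hkn := rasy_nat_mul_pow_sub_one_le k n hn0
    have hαc : 0 ≤ α * c := by positivity
    calc α * n * t = α * c * ((n : ℝ) * ((1 + 1 / (n : ℝ)) ^ k - 1)) := by simp only [ht]; ring
      _ ≤ α * c * (k * Real.exp (k / n)) := mul_le_mul_of_nonneg_left hkn hαc
      _ = k * α * c * Real.exp (k / n) := by ring
  have h3 : c * ((1 + t) ^ m - 1) ≤ c * (Real.exp (k * α * c * Real.exp ((k : ℝ) / n)) - 1) :=
    mul_le_mul_of_nonneg_left (by linarith [Real.exp_le_exp.mpr h2, h1]) hc0.le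
  exact h3.trans hn

end Summit.PneNP.PneNP.Cruxes.SolvableImpliesStableSection.Sketch
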